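import Summits.BirchSwinnertonDyer.BirchSwinnertonDyer.Theorems.Rank1ResidualJetSection6BridgeSwap
import HarnessLib

/-!
# T1 JET (cell `bsd-jet`), road K — striking McCallum 1991 Prop. 5.2 (`h52`), brick 5b: the reading
# binders K3 / K1 / K4 from «level raising at minimal depth» (`hR`) + the MINIMAL `H`

HONEST FRAMING (programme file §HONESTY, verbatim): «no tranche here proves BSD; ARM L moves the
LITERAL column of an r ≤ 1 census into the kernel-proved-modulo-named-print column.» THEOREMS ONLY
(seat `bsd-jet-pv-2`, session g6; `--supports stmt-BirchSwinnertonDyer-14418`, helper); 0 classes move;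
road-K DOCUMENTARY; the three binders stay CONDITIONAL on `hR` and `H`.

WHAT. pv-2 g2's `jetchevDivisibilityCarrier{Mult,Ne,Add}_of_prop52_of_section6_min`
(`Rank1ResidualJetSection6BridgeMin`) with `h52` (McCallum Prop. 5.2, typed named print) replaced by
`hR` = the conclusion of brick 4 `Swap.exists_conductor_levelIndex_ge_of_minDepth` quantified over the
frame (level raising at minimal depth, Kolyvagin's prime-swap walk in the kernel), over brick 5
`derivedPoint_divisible_of_levelRaising_of_section6_min`. Re-threading the END FORMS
(`…_of_namedPrintOnly`) on these twins removes `h52` from road K's named-print list in favour of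
{McCallum 4.4, Poitou–Tate package, [GZ86 III (3.1)]} (already there) + the plumbing binder `hcompat`.
References (locators only): [cite: Jetchev2008, Thm. 1.1 (p. 812) and its proof (p. 824)]
[cite: McCallumLMS1991, §5 Prop. 5.2 (p. 304)]. Design: no definitions; `K : Type`. Axioms:
`propext`, `Classical.choice`, `Quot.sound`.
-/

set_option autoImplicit false

noncomputable section

open scoped Classical

open WeierstrassCurve Literature.NumberTheory.EllipticCurves
  Literature.NumberTheory.EllipticCurves.ModularForms

namespace Summit.BirchSwinnertonDyer.Rank1Residual.JET

/-- **K3 from LEVEL RAISING AT MINIMAL DEPTH (`hR`) + the MINIMAL `H`** (Prop. 6.4 at `k ≥ 1`, `m(c) = m_∞`; Thm. 6.3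
at `k ≥ 1`), `t := ord_p c_p(E)`. Bookkeeping over `derivedPoint_divisible_of_levelRaising_of_section6_min`; `hR` = brick 4's conclusion, quantified over the frame.
[cite: Jetchev2008, Thm. 1.1 (p. 812) and its proof (p. 824)] [cite: McCallumLMS1991, §5 Prop. 5.2 (p. 304)] -/
theorem jetchevDivisibilityCarrierMult_of_levelRaising_of_section6_min
    (hR : ∀ (W : WeierstrassCurve ℚ) [W.IsElliptic] [W.IsGloballyMinimal] [NeZero (W.conductorNorm ℤ)],
      ¬ W.HasCM → ∀ (K : Type) [Field K] [NumberField K], IsImaginaryQuadratic K →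
      NumberField.discr K ≠ -3 → NumberField.discr K ≠ -4 →
      SatisfiesHeegnerHypothesis (W.conductorNorm ℤ) K →
      ∀ (p : ℕ) [Fact p.Prime], p ≠ 2 → (∀ n : ℕ, W.HasSurjectiveModNGaloisRep (p ^ n : ℕ)) →
      ∀ (Dt : ModularParametrizationData W (W.conductorNorm ℤ)) (β : ℤ) (ι : K →+* ℂ) (u : ℕ),
      (∀ (c : ℕ), Squarefree c →
        (∀ q ∈ c.primeFactors, Zhang2014.IsKolyvaginPrime (W.conductorNorm ℤ) W K p q ∧
          1 + u ≤ Zhang2014.kolyvaginIndex W p q) →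
        ∀ dc : KolyvaginHeegnerData Dt β ι c,
        ∃ Q : (W.baseChange (ringClassField K ι c)).toAffine.Point,
          ((p ^ u : ℕ) : ℤ) • Q = dc.derivedPoint) →
      ∀ (n₀ : ℕ), Squarefree n₀ →
        (∀ q ∈ n₀.primeFactors, Zhang2014.IsKolyvaginPrime (W.conductorNorm ℤ) W K p q ∧
          1 + u ≤ Zhang2014.kolyvaginIndex W p q) →
        ∀ d₀ : KolyvaginHeegnerData Dt β ι n₀,
        (¬ ∃ Q : (W.baseChange (ringClassField K ι n₀)).toAffine.Point,
          ((p ^ (u + 1) : ℕ) : ℤ) • Q = d₀.derivedPoint) →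
        ∀ m' : ℕ, ∃ (n : ℕ) (d : KolyvaginHeegnerData Dt β ι n), Squarefree n ∧
          (∀ q ∈ n.primeFactors, Zhang2014.IsKolyvaginPrime (W.conductorNorm ℤ) W K p q ∧
            max m' (1 + u) ≤ Zhang2014.kolyvaginIndex W p q) ∧
          ¬ ∃ Q : (W.baseChange (ringClassField K ι n)).toAffine.Point,
            ((p ^ (u + 1) : ℕ) : ℤ) • Q = d.derivedPoint)
    (H : ∀ (W : WeierstrassCurve ℚ) [W.IsElliptic] [W.IsGloballyMinimal] [NeZero (W.conductorNorm ℤ)],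
      ¬ W.HasCM → ∀ (K : Type) [Field K] [NumberField K], IsImaginaryQuadratic K →
      NumberField.discr K ≠ -3 → NumberField.discr K ≠ -4 →
      SatisfiesHeegnerHypothesis (W.conductorNorm ℤ) K →
      ∀ (p : ℕ) [Fact p.Prime], p ≠ 2 → W.HasMultiplicativeReductionAtPrime p →
      (∀ n : ℕ, W.HasSurjectiveModNGaloisRep (p ^ n : ℕ)) →
      ∀ (Dt : ModularParametrizationData W (W.conductorNorm ℤ)) (β : ℤ) (ι : K →+* ℂ)
        (d₁ : KolyvaginHeegnerData Dt β ι 1), ¬ IsOfFinAddOrder d₁.derivedPoint →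
      ∀ (mdiv m : {c : ℕ // Squarefree c ∧ ∀ ℓ ∈ c.primeFactors,
          Zhang2014.IsKolyvaginPrime (W.conductorNorm ℤ) W K p ℓ} → ℕ∞),
      (∀ c (u : ℕ), (u : ℕ∞) ≤ mdiv c ↔ ∀ d : KolyvaginHeegnerData Dt β ι c.1,
        ∃ Q : (W.baseChange (ringClassField K ι c.1)).toAffine.Point,
          ((p ^ u : ℕ) : ℤ) • Q = d.derivedPoint) →
      (∀ c, m c = if mdiv c < Zhang2014.levelIndex W p c.1 then mdiv c else ⊤) →
      ∀ mInf : ℕ, (∀ c, (mInf : ℕ∞) ≤ m c) →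
        (∀ m' : ℕ, ∃ c, (m' : ℕ∞) ≤ Zhang2014.levelIndex W p c.1 ∧ m c = mInf) →
      ∃ Core : ℕ → {c : ℕ // Squarefree c ∧ ∀ ℓ ∈ c.primeFactors,
          Zhang2014.IsKolyvaginPrime (W.conductorNorm ℤ) W K p ℓ} → Prop,
        (∀ (k : ℕ) c, 1 ≤ k → m c = mInf → (mInf : ℕ∞) + k ≤ Zhang2014.levelIndex W p c.1 →
          ∃ c', Core k c' ∧ (k : ℕ∞) + mInf ≤ Zhang2014.levelIndex W p c'.1 ∧ m c' ≤ mInf) ∧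
        (∀ (k : ℕ) c, 1 ≤ k → Core k c → m c = mInf →
          (k : ℕ∞) + mInf ≤ Zhang2014.levelIndex W p c.1 →
          padicValNat p ((W.baseChange ℚ_[p]).localTamagawaNumber ℤ_[p]) < k → mInf < k →
          padicValNat p ((W.baseChange ℚ_[p]).localTamagawaNumber ℤ_[p]) ≤ mInf)) :
    JetchevDivisibilityCarrierMult := by
  intro W _ _ _ hcm K _ _ hK hD3 hD4 hH p _ hp2 hmult htower Dt β ι d₁ hy s hs n d hn hℓ
  exact derivedPoint_divisible_of_levelRaising_of_section6_min W K p Dt β ι _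
    (hR W hcm K hK hD3 hD4 hH p hp2 htower Dt β ι) (H W hcm K hK hD3 hD4 hH p hp2 hmult htower Dt β ι d₁ hy)
    s hs n d hn hℓ

/-- **K1 from LEVEL RAISING AT MINIMAL DEPTH (`hR`) + the MINIMAL `H`**, `t := ord_p c_q(E)` at a carrier `q ∣ N`,
`q ≠ p`. Bookkeeping. [cite: Jetchev2008, Thm. 1.1 (p. 812) and its proof (p. 824)] [cite: McCallumLMS1991, §5 Prop. 5.2 (p. 304)] -/
theorem jetchevDivisibilityCarrierNe_of_levelRaising_of_section6_min
    (hR : ∀ (W : WeierstrassCurve ℚ) [W.IsElliptic] [W.IsGloballyMinimal] [NeZero (W.conductorNorm ℤ)],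
      ¬ W.HasCM → ∀ (K : Type) [Field K] [NumberField K], IsImaginaryQuadratic K →
      NumberField.discr K ≠ -3 → NumberField.discr K ≠ -4 →
      SatisfiesHeegnerHypothesis (W.conductorNorm ℤ) K →
      ∀ (p : ℕ) [Fact p.Prime], p ≠ 2 → (∀ n : ℕ, W.HasSurjectiveModNGaloisRep (p ^ n : ℕ)) →
      ∀ (Dt : ModularParametrizationData W (W.conductorNorm ℤ)) (β : ℤ) (ι : K →+* ℂ) (u : ℕ),
      (∀ (c : ℕ), Squarefree c →
        (∀ q ∈ c.primeFactors, Zhang2014.IsKolyvaginPrime (W.conductorNorm ℤ) W K p q ∧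
          1 + u ≤ Zhang2014.kolyvaginIndex W p q) →
        ∀ dc : KolyvaginHeegnerData Dt β ι c,
        ∃ Q : (W.baseChange (ringClassField K ι c)).toAffine.Point,
          ((p ^ u : ℕ) : ℤ) • Q = dc.derivedPoint) →
      ∀ (n₀ : ℕ), Squarefree n₀ →
        (∀ q ∈ n₀.primeFactors, Zhang2014.IsKolyvaginPrime (W.conductorNorm ℤ) W K p q ∧
          1 + u ≤ Zhang2014.kolyvaginIndex W p q) →
        ∀ d₀ : KolyvaginHeegnerData Dt β ι n₀,
        (¬ ∃ Q : (W.baseChange (ringClassField K ι n₀)).toAffine.Point,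
          ((p ^ (u + 1) : ℕ) : ℤ) • Q = d₀.derivedPoint) →
        ∀ m' : ℕ, ∃ (n : ℕ) (d : KolyvaginHeegnerData Dt β ι n), Squarefree n ∧
          (∀ q ∈ n.primeFactors, Zhang2014.IsKolyvaginPrime (W.conductorNorm ℤ) W K p q ∧
            max m' (1 + u) ≤ Zhang2014.kolyvaginIndex W p q) ∧
          ¬ ∃ Q : (W.baseChange (ringClassField K ι n)).toAffine.Point,
            ((p ^ (u + 1) : ℕ) : ℤ) • Q = d.derivedPoint)
    (H : ∀ (W : WeierstrassCurve ℚ) [W.IsElliptic] [W.IsGloballyMinimal] [NeZero (W.conductorNorm ℤ)],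
      ¬ W.HasCM → ∀ (K : Type) [Field K] [NumberField K], IsImaginaryQuadratic K →
      NumberField.discr K ≠ -3 → NumberField.discr K ≠ -4 →
      SatisfiesHeegnerHypothesis (W.conductorNorm ℤ) K →
      ∀ (p : ℕ) [Fact p.Prime], p ≠ 2 → (∀ n : ℕ, W.HasSurjectiveModNGaloisRep (p ^ n : ℕ)) →
      ∀ (Dt : ModularParametrizationData W (W.conductorNorm ℤ)) (β : ℤ) (ι : K →+* ℂ)
        (d₁ : KolyvaginHeegnerData Dt β ι 1), ¬ IsOfFinAddOrder d₁.derivedPoint →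
      ∀ (q : ℕ) [Fact q.Prime], q ∣ W.conductorNorm ℤ → q ≠ p →
      ∀ (mdiv m : {c : ℕ // Squarefree c ∧ ∀ ℓ ∈ c.primeFactors,
          Zhang2014.IsKolyvaginPrime (W.conductorNorm ℤ) W K p ℓ} → ℕ∞),
      (∀ c (u : ℕ), (u : ℕ∞) ≤ mdiv c ↔ ∀ d : KolyvaginHeegnerData Dt β ι c.1,
        ∃ Q : (W.baseChange (ringClassField K ι c.1)).toAffine.Point,
          ((p ^ u : ℕ) : ℤ) • Q = d.derivedPoint) →
      (∀ c, m c = if mdiv c < Zhang2014.levelIndex W p c.1 then mdiv c else ⊤) →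
      ∀ mInf : ℕ, (∀ c, (mInf : ℕ∞) ≤ m c) →
        (∀ m' : ℕ, ∃ c, (m' : ℕ∞) ≤ Zhang2014.levelIndex W p c.1 ∧ m c = mInf) →
      ∃ Core : ℕ → {c : ℕ // Squarefree c ∧ ∀ ℓ ∈ c.primeFactors,
          Zhang2014.IsKolyvaginPrime (W.conductorNorm ℤ) W K p ℓ} → Prop,
        (∀ (k : ℕ) c, 1 ≤ k → m c = mInf → (mInf : ℕ∞) + k ≤ Zhang2014.levelIndex W p c.1 →
          ∃ c', Core k c' ∧ (k : ℕ∞) + mInf ≤ Zhang2014.levelIndex W p c'.1 ∧ m c' ≤ mInf) ∧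
        (∀ (k : ℕ) c, 1 ≤ k → Core k c → m c = mInf →
          (k : ℕ∞) + mInf ≤ Zhang2014.levelIndex W p c.1 →
          padicValNat p ((W.baseChange ℚ_[q]).localTamagawaNumber ℤ_[q]) < k → mInf < k →
          padicValNat p ((W.baseChange ℚ_[q]).localTamagawaNumber ℤ_[q]) ≤ mInf)) :
    JetchevDivisibilityCarrierNe := by
  intro W _ _ _ hcm K _ _ hK hD3 hD4 hH p _ hp2 htower Dt β ι d₁ hy q _ hqN hqp s hs n d hn hℓ
  exact derivedPoint_divisible_of_levelRaising_of_section6_min W K p Dt β ι _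
    (hR W hcm K hK hD3 hD4 hH p hp2 htower Dt β ι) (H W hcm K hK hD3 hD4 hH p hp2 htower Dt β ι d₁ hy q hqN hqp)
    s hs n d hn hℓ

/-- **K4 from LEVEL RAISING AT MINIMAL DEPTH (`hR`) + the MINIMAL `H`**, `t := ord_p c_p(E)`, `E` additive at
`p`. Bookkeeping. [cite: Jetchev2008, Thm. 1.1 (p. 812) and its proof (p. 824)] [cite: McCallumLMS1991, §5 Prop. 5.2 (p. 304)] -/
theorem jetchevDivisibilityCarrierAdd_of_levelRaising_of_section6_min
    (hR : ∀ (W : WeierstrassCurve ℚ) [W.IsElliptic] [W.IsGloballyMinimal] [NeZero (W.conductorNorm ℤ)],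
      ¬ W.HasCM → ∀ (K : Type) [Field K] [NumberField K], IsImaginaryQuadratic K →
      NumberField.discr K ≠ -3 → NumberField.discr K ≠ -4 →
      SatisfiesHeegnerHypothesis (W.conductorNorm ℤ) K →
      ∀ (p : ℕ) [Fact p.Prime], p ≠ 2 → (∀ n : ℕ, W.HasSurjectiveModNGaloisRep (p ^ n : ℕ)) →
      ∀ (Dt : ModularParametrizationData W (W.conductorNorm ℤ)) (β : ℤ) (ι : K →+* ℂ) (u : ℕ),
      (∀ (c : ℕ), Squarefree c →
        (∀ q ∈ c.primeFactors, Zhang2014.IsKolyvaginPrime (W.conductorNorm ℤ) W K p q ∧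
          1 + u ≤ Zhang2014.kolyvaginIndex W p q) →
        ∀ dc : KolyvaginHeegnerData Dt β ι c,
        ∃ Q : (W.baseChange (ringClassField K ι c)).toAffine.Point,
          ((p ^ u : ℕ) : ℤ) • Q = dc.derivedPoint) →
      ∀ (n₀ : ℕ), Squarefree n₀ →
        (∀ q ∈ n₀.primeFactors, Zhang2014.IsKolyvaginPrime (W.conductorNorm ℤ) W K p q ∧
          1 + u ≤ Zhang2014.kolyvaginIndex W p q) →
        ∀ d₀ : KolyvaginHeegnerData Dt β ι n₀,
        (¬ ∃ Q : (W.baseChange (ringClassField K ι n₀)).toAffine.Point,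
          ((p ^ (u + 1) : ℕ) : ℤ) • Q = d₀.derivedPoint) →
        ∀ m' : ℕ, ∃ (n : ℕ) (d : KolyvaginHeegnerData Dt β ι n), Squarefree n ∧
          (∀ q ∈ n.primeFactors, Zhang2014.IsKolyvaginPrime (W.conductorNorm ℤ) W K p q ∧
            max m' (1 + u) ≤ Zhang2014.kolyvaginIndex W p q) ∧
          ¬ ∃ Q : (W.baseChange (ringClassField K ι n)).toAffine.Point,
            ((p ^ (u + 1) : ℕ) : ℤ) • Q = d.derivedPoint)
    (H : ∀ (W : WeierstrassCurve ℚ) [W.IsElliptic] [W.IsGloballyMinimal] [NeZero (W.conductorNorm ℤ)],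
      ¬ W.HasCM → ∀ (K : Type) [Field K] [NumberField K], IsImaginaryQuadratic K →
      NumberField.discr K ≠ -3 → NumberField.discr K ≠ -4 →
      SatisfiesHeegnerHypothesis (W.conductorNorm ℤ) K →
      ∀ (p : ℕ) [Fact p.Prime], p ≠ 2 →
      ¬ W.HasGoodReductionAtPrime p → ¬ W.HasMultiplicativeReductionAtPrime p →
      (∀ n : ℕ, W.HasSurjectiveModNGaloisRep (p ^ n : ℕ)) →
      ∀ (Dt : ModularParametrizationData W (W.conductorNorm ℤ)) (β : ℤ) (ι : K →+* ℂ)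
        (d₁ : KolyvaginHeegnerData Dt β ι 1), ¬ IsOfFinAddOrder d₁.derivedPoint →
      ∀ (mdiv m : {c : ℕ // Squarefree c ∧ ∀ ℓ ∈ c.primeFactors,
          Zhang2014.IsKolyvaginPrime (W.conductorNorm ℤ) W K p ℓ} → ℕ∞),
      (∀ c (u : ℕ), (u : ℕ∞) ≤ mdiv c ↔ ∀ d : KolyvaginHeegnerData Dt β ι c.1,
        ∃ Q : (W.baseChange (ringClassField K ι c.1)).toAffine.Point,
          ((p ^ u : ℕ) : ℤ) • Q = d.derivedPoint) →
      (∀ c, m c = if mdiv c < Zhang2014.levelIndex W p c.1 then mdiv c else ⊤) →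
      ∀ mInf : ℕ, (∀ c, (mInf : ℕ∞) ≤ m c) →
        (∀ m' : ℕ, ∃ c, (m' : ℕ∞) ≤ Zhang2014.levelIndex W p c.1 ∧ m c = mInf) →
      ∃ Core : ℕ → {c : ℕ // Squarefree c ∧ ∀ ℓ ∈ c.primeFactors,
          Zhang2014.IsKolyvaginPrime (W.conductorNorm ℤ) W K p ℓ} → Prop,
        (∀ (k : ℕ) c, 1 ≤ k → m c = mInf → (mInf : ℕ∞) + k ≤ Zhang2014.levelIndex W p c.1 →
          ∃ c', Core k c' ∧ (k : ℕ∞) + mInf ≤ Zhang2014.levelIndex W p c'.1 ∧ m c' ≤ mInf) ∧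
        (∀ (k : ℕ) c, 1 ≤ k → Core k c → m c = mInf →
          (k : ℕ∞) + mInf ≤ Zhang2014.levelIndex W p c.1 →
          padicValNat p ((W.baseChange ℚ_[p]).localTamagawaNumber ℤ_[p]) < k → mInf < k →
          padicValNat p ((W.baseChange ℚ_[p]).localTamagawaNumber ℤ_[p]) ≤ mInf)) :
    JetchevDivisibilityCarrierAdd := by
  intro W _ _ _ hcm K _ _ hK hD3 hD4 hH p _ hp2 hgood hmult htower Dt β ι d₁ hy s hs n d hn hℓ
  exact derivedPoint_divisible_of_levelRaising_of_section6_min W K p Dt β ι _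
    (hR W hcm K hK hD3 hD4 hH p hp2 htower Dt β ι) (H W hcm K hK hD3 hD4 hH p hp2 hgood hmult htower Dt β ι d₁ hy)
    s hs n d hn hℓ

end Summit.BirchSwinnertonDyer.Rank1Residual.JET

end
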